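import Summits.ResolutionOfSingularities.ResolutionOfSingularities.Theorems.MarkedTransferCampaignW46ThreefoldsGammaFreeGlobalLadder
import Literature.AlgebraicGeometry.Resolution.MonomialOrderReduction
import Literature.AlgebraicGeometry.Resolution.KollarMaxContactPersistence
import HarnessLib

/-!
# [OURS · L1 W4.6 rung (ii-M)] THE MONOMIAL / DIVISORIAL SLICE OF THE DIMENSION LADDER — `OrderReducible (Π 𝓘_{E_j}^{a_j}) m`
# for every simple-normal-crossings boundary, in EVERY dimension (in particular `d = 3`), PROVED

Cell res-hironaka, LADDER-RESOLUTION rung L (D-0089), slot W4.6 «restricted-regime rungs of the typed Th. 16.6 procedure»,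
rung (ii) (threefold hypersurfaces) in the DIMENSION LADDER of the Γ-free global order-reduction statement (typer
res-L1-type-o1: `…ThreefoldsGammaFreeGlobal.lean` p493059 `IsPermissibleBlowupSeq`, `GammaFreeGlobalOrderReductionDimLeThree`;
`…ThreefoldsGammaFreeGlobalLadder.lean` p496755 `OrderReducible I m`, `GammaFreeGlobalOrderReductionDimLE p d`). Seat
res-L1-s46-pv-3 (gen 3). Host route MarkedTransfer, host item `HypersurfaceOrderReductionDimLeThree`
(stmt-ResolutionOfSingularities-16156); filed `--kind proof --supports` it `--as helper`. Everything here is OURS: kernel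
theorems over the campaign definitions and PROVED tree lemmas; NOTHING is a statement of Hironaka's manuscript; no typed
`Hironaka2017` candidate enters; no `Literature.…` named FACT is used as a hypothesis. AI-written; AI review is weaker than
expert review.

## What is proved (no new definitions)

* `CampaignW46.orderReducible_monomialIdeal` — **THE MONOMIAL SLICE, every dimension**: on a locally Noetherian scheme `X`,
  for every list `E = [(𝓘_{E_1}, a_1), …, (𝓘_{E_r}, a_r)]` of ideal sheaves with exponents whose boundary `(𝓘_{E_j})_j`
  has simple normal crossings (tree `HasSNC`, which contains the regularity of `X`) and every `m ≥ 1`, the MONOMIAL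
  hypersurface ideal `I = Π_j 𝓘_{E_j}^{a_j}` (tree `monomialIdeal E`) is order-reducible: `OrderReducible I m`, i.e. there is
  a sequence of permissible blowing-ups for `(I, m)` (regular centres inside the successive loci of order `≥ m` of the
  WHOLE stages, controlled transforms with exponent `m`) ending with order `< m` everywhere. The centres are Kollár's
  strata `E_{j_1} ∩ ⋯ ∩ E_{j_s}` of maximal weight `a_{j_1} + ⋯ + a_{j_s} ≥ m` (Kollár 2007 (3.111) Step 3 / BGMW 2011 §4
  Step 2b — the COMBINATORIAL, characteristic-free part of order reduction), as PROVED in the tree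
  (`exists_isMarkedResolution_monomialMarked`, `Resolution/MonomialOrderReduction.lean`); the passage from a BGMW marked
  resolution to the campaign's `IsPermissibleBlowupSeq` + `ord < m` is o1's calibration core
  `isPermissibleBlowupSeq_and_idealOrder_lt_of_isMarkedResolution`. NO bound on the dimension and NO base field is needed.
* `CampaignW46.orderReducible_pow_of_hasSNC_singleton` / `…_of_generator` — **THE DIVISORIAL SLICE**: a power `𝓘_S^a` of
  the ideal of a single simple-normal-crossings divisor `S` (equivalently, on a regular locally Noetherian `X`: an ideal sheaf
  generated at each point of its support by an element of order one — a REGULAR HYPERSURFACE) is order-reducible for every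
  `m ≥ 1` (the sequence: blow up `S` itself `⌈(a - m + 1)/m⌉₊` times — identities, `S` being Cartier — dividing by `𝓘_S^m`).
* `CampaignW46.gammaFreeGlobalDimLE_monomial_slice` — the same READ IN THE LADDER'S BINDERS: for every prime `p`, every
  `d`, every perfect field `k` of characteristic `p`, every separated / locally-of-finite-type / quasi-compact / integral /
  regular `k`-scheme `X` of dimension `≤ d`, every effective Cartier `I ≠ 0` WHICH IS AN SNC MONOMIAL
  (`∃ E, HasSNC (boundaryOf E) ∧ I = monomialIdeal E`) and every `m ≥ 1`: `OrderReducible I m`. (Binders byte-identical to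
  `GammaFreeGlobalOrderReductionDimLE p d` plus the one monomiality hypothesis; most binders are not used.)

HONEST VALUE. This is a SLICE of each rung `d` (including the statement of record `d = 3`), not a rung: it covers exactly
the inputs `(X, I, m)` whose hypersurface ideal is a monomial in a simple-normal-crossings boundary — the «Γ-part» that a
boundary-carrying procedure isolates, here reached Γ-free because the conclusion `OrderReducible` forgets the boundary. It
is a NON-VACUOUS inhabitant of the conclusion shape at every `d` (the regime-(ii) kernel witness of
`…ThreefoldsWitness.lean` p490164, the double plane `((x₂)², 2)` in affine 3-space, is such an input — companion file
`…ThreefoldsGammaFreeGlobalMonomialWitness.lean`). It says nothing about non-monomial inputs (where the mathematics of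
rung (ii) lives: embedded surfaces of a regular threefold), about the typed procedure's résumés, or about the manuscript.
The mathematics is the tree's (Kollár Step 3, kernel-checked there); this file is the 40-line bridge to the campaign's words.

References: `…ThreefoldsGammaFreeGlobalLadder.lean` (p496755), `…ThreefoldsGammaFreeGlobal.lean` (p493059); tree
`Resolution/MonomialOrderReduction.lean` (`exists_isMarkedResolution_monomialMarked` [Kollar2007, (3.111) Step 3]
[BierstoneGrigorievMilmanWlodarczyk2011, §4 Step 2b]), `Resolution/MonomialMarkedIdeals.lean` (`monomialIdeal`,
`boundaryOf`, `monomialMarked`), `Resolution/KollarMaxContactPersistence.lean` (`hasSNC_singleton_of_generator`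
[Matsumura1987, Thm. 14.2]), `Resolution/MarkedIdeals.lean` (`HasSNC`, `IsMarkedResolution`
[BierstoneGrigorievMilmanWlodarczyk2011, Def. 3.1.3]). H. Hironaka, ms. 2017-03-23, §2.1 p.4, Def. 2.1 p.5, Th. 16.13
p.87 — scope only, under adjudication, not cited as fact. [Hironaka2017]
-/

noncomputable section

set_option linter.dupNamespace false -- mandated namespace of this single-conjunct summit

open CategoryTheory AlgebraicGeometry TopologicalSpace IsLocalRing

namespace Summit.ResolutionOfSingularities.ResolutionOfSingularities.Theorems

namespace CampaignW46

open Literature.AlgebraicGeometry.Resolution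
open Scheme.IdealSheafData

universe u

variable {X : Scheme.{u}}

/-! ## §1 The monomial slice: Kollár's Step 3 in the campaign's words -/

/-- **THE MONOMIAL SLICE OF Γ-FREE ORDER REDUCTION, EVERY DIMENSION.** On a locally Noetherian scheme `X`, let
`E = [(𝓘_{E_1}, a_1), …, (𝓘_{E_r}, a_r)]` be ideal sheaves with exponents whose boundary has simple normal crossings
(`HasSNC (boundaryOf E)`; this includes: `X` is regular) and let `m ≥ 1`. Then the monomial ideal
`I = Π_j 𝓘_{E_j}^{a_j}` is ORDER-REDUCIBLE BY PERMISSIBLE BLOWING-UPS: `OrderReducible (monomialIdeal E) m` — there are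
`X′`, `Φ : X′ ⟶ X`, `J′` with `IsPermissibleBlowupSeq (monomialIdeal E) m Φ J′` and `ord_x J′ < m` for all `x : X′`.
Proof: Kollár (3.111) Step 3 as PROVED in the tree (`exists_isMarkedResolution_monomialMarked`: a BGMW marked resolution
of `(X, Π 𝓘_{E_j}^{a_j}, (E_j), m)` by blowing up strata of maximal weight), read through o1's calibration core
(`isPermissibleBlowupSeq_and_idealOrder_lt_of_isMarkedResolution`: a marked resolution is a sequence of permissible
blowing-ups ending below order `m`). [cite: Kollar2007, (3.111) Step 3] -/
theorem orderReducible_monomialIdeal [IsLocallyNoetherian X] (E : List (X.IdealSheafData × ℕ))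
    (hE : HasSNC (boundaryOf E)) {m : ℕ} (hm : 1 ≤ m) : OrderReducible (monomialIdeal E) m := by
  obtain ⟨s, hs⟩ := exists_isMarkedResolution_monomialMarked E hE hm
  have hs' : IsMarkedResolution (⟨monomialIdeal E, boundaryOf E, m⟩ : MarkedIdeal X) s.comp
      (s.transformMarked (monomialMarked E m)) := hs
  obtain ⟨hseq, hlt⟩ := isPermissibleBlowupSeq_and_idealOrder_lt_of_isMarkedResolution hs'
  exact ⟨_, s.comp, _, hseq, hlt⟩

/-- The monomial slice for an ideal sheaf GIVEN as an SNC monomial: if `I = Π_j 𝓘_{E_j}^{a_j}` for some exponent list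
with simple-normal-crossings boundary, then `(X, I, m)` is order-reducible for every `m ≥ 1`.
[cite: Kollar2007, (3.111) Step 3] -/
theorem orderReducible_of_eq_monomialIdeal [IsLocallyNoetherian X] {I : X.IdealSheafData}
    (hI : ∃ E : List (X.IdealSheafData × ℕ), HasSNC (boundaryOf E) ∧ I = monomialIdeal E) {m : ℕ} (hm : 1 ≤ m) :
    OrderReducible I m := by
  obtain ⟨E, hE, rfl⟩ := hI
  exact orderReducible_monomialIdeal E hE hm

/-! ## §2 The divisorial slice: powers of one simple-normal-crossings divisor -/

/-- **THE DIVISORIAL SLICE.** If the single ideal sheaf `H` is a simple-normal-crossings divisor on `X` (`HasSNC [H]`: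
`X` regular and, at each point of `V(H)`, `H_x` generated by a member of a regular system of parameters), then every
power `H ^ a` is order-reducible for every `m ≥ 1`: `OrderReducible (H ^ a) m`. (The one-entry case of the monomial
slice; the resolving sequence blows up `V(H)` itself — a Cartier centre, so each step is an identity dividing by `H^m` —
until the exponent drops below `m`.) [cite: Kollar2007, (3.111) Step 3] -/
theorem orderReducible_pow_of_hasSNC_singleton [IsLocallyNoetherian X] {H : X.IdealSheafData} (hH : HasSNC [H])
    (a : ℕ) {m : ℕ} (hm : 1 ≤ m) : OrderReducible (H ^ a) m := by
  have h := orderReducible_monomialIdeal [(H, a)] hH hm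
  rwa [monomialIdeal_singleton] at h

/-- **THE DIVISORIAL SLICE, REGULAR-HYPERSURFACE FORM.** On a regular locally Noetherian scheme `X`, let `H` be an ideal
sheaf generated at every point `x` of its support by ONE element of order one (`H_x = (v)`, `v ∉ 𝔪_x²` — i.e. `V(H)` is
a regular hypersurface, `𝒪_{X,x}/(v)` regular by Matsumura Thm. 14.2). Then `OrderReducible (H ^ a) m` for all `a` and
all `m ≥ 1`. (`[H]` has simple normal crossings by the tree's `hasSNC_singleton_of_generator`.)
[cite: Matsumura1987, Thm. 14.2] -/
theorem orderReducible_pow_of_generator [IsLocallyNoetherian X] (hX : Scheme.IsRegular X) {H : X.IdealSheafData}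
    (hH : ∀ x ∈ H.support, ∃ v : X.presheaf.stalk x,
      stalkIdeal H x = Ideal.span {v} ∧ v ∉ (maximalIdeal (X.presheaf.stalk x)) ^ 2)
    (a : ℕ) {m : ℕ} (hm : 1 ≤ m) : OrderReducible (H ^ a) m :=
  orderReducible_pow_of_hasSNC_singleton (hasSNC_singleton_of_generator hX hH) a hm

/-- The case `a = 1`: the ideal of a simple-normal-crossings divisor itself is order-reducible for every `m ≥ 1` (for
`m = 1` by one identity blow-up of `V(H)`; for `m ≥ 2` its order is already `≤ 1 < m`). [cite: Kollar2007, (3.111) Step 3] -/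
theorem orderReducible_of_hasSNC_singleton [IsLocallyNoetherian X] {H : X.IdealSheafData} (hH : HasSNC [H])
    {m : ℕ} (hm : 1 ≤ m) : OrderReducible H m := by
  simpa using orderReducible_pow_of_hasSNC_singleton hH 1 hm

/-! ## §3 In the ladder's binders -/

/-- **THE MONOMIAL SLICE OF EVERY RUNG OF THE LADDER, in the binders of `GammaFreeGlobalOrderReductionDimLE p d`** (typer
o1, p496755) plus ONE hypothesis — monomiality of `I` in some simple-normal-crossings boundary: for every prime `p` and
every `d` (in particular `d = 3`, the statement of record), every perfect field `k` of characteristic `p`, every separated,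
locally-of-finite-type, quasi-compact, integral, regular `k`-scheme `X` with `topologicalKrullDim X ≤ d`, every effective
Cartier `I ≠ 0` with `I = Π_j 𝓘_{E_j}^{a_j}` for an exponent list `E` with `HasSNC (boundaryOf E)`, and every `m ≥ 1`:
`OrderReducible I m`. Only local Noetherianity (from local finite type over a field) and the monomiality are used — the
slice is dimension-free and characteristic-free. [cite: Kollar2007, (3.111) Step 3] -/
theorem gammaFreeGlobalDimLE_monomial_slice (p d : ℕ) :
    p.Prime → ∀ (k : Type u) [Field k] [CharP k p] [PerfectField k] (X : Scheme.{u}) (s : X ⟶ Spec (.of k)),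
      IsSeparated s → LocallyOfFiniteType s → QuasiCompact s → IsIntegral X → Scheme.IsRegular X →
        topologicalKrullDim X ≤ d → ∀ (I : X.IdealSheafData), I ≠ ⊥ → IsEffectiveCartier I →
          (∃ E : List (X.IdealSheafData × ℕ), HasSNC (boundaryOf E) ∧ I = monomialIdeal E) →
            ∀ (m : ℕ), 1 ≤ m → OrderReducible I m := by
  intro _ k _ _ _ X s _ hloft _ _ _ _ I _ _ hI m hm
  haveI : IsLocallyNoetherian X := LocallyOfFiniteType.isLocallyNoetherian s
  exact orderReducible_of_eq_monomialIdeal hI hm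

end CampaignW46

end Summit.ResolutionOfSingularities.ResolutionOfSingularities.Theorems

end
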